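import Summits.Ventures.Crystal3D.Theorems.StickyWulffConstantCoaxialWallLawAzimuthScheduling
import Mathlib.Analysis.SpecialFunctions.Trigonometric.Bounds
import Mathlib.Analysis.Real.Pi.Bounds
import HarnessLib

/-!
# The planar-heights kissing row at offset `½`, brick 1: species, certified separations, the KEY inequalities

HONEST FRAMING. Part of the venture `Summits/Ventures/Crystal3D` (cell `crystal3d-full`), helper
`--supports` the crux `CoaxialWallLaw` (stmt-Ventures-19481, `route-Ventures-StickyWulffConstant`),
REGISTERED line `WallLedgerF`, open stub `stub_coaxialTwoSlabAdhesion`.  RUNG CREDIT ONLY; F-C1 not moved.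

THE ROW AT `τ = ½` (the offset of lit's rigid optimum `T*`): unit contact directions at frame heights in
`(√(2/3)/2)·ℤ` come in five SPECIES `h ∈ {0, ±a, ±2a}`, `a = √(2/3)/2` (`hpH`), with horizontal radii
`r = √(1 − h²)` (`hpR`).  Two contacts of species `s, t` at distance `≥ 1` have azimuths at least
`δ(s,t) = arccos((½ − h_s h_t)/(r_s r_t))` apart; this file fixes CERTIFIED LOWER BOUNDS `hpDelta` for these
angles (`π/3, π/6, 2π/3` exact; `0.98, 1.15, 0.62, 1.24` rational) and proves the KEY inequalities
`r_s r_t cos δ(s,t) ≥ ½ − h_s h_t` (`hp_key`, via `sin t ≥ t − t³/6`, `cos t ≥ 1 − t²/2`, `π` to six digits),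
and that the integer table `hpTbl` (units `10⁻⁴ rad`) under-estimates `10⁴·δ` (`hp_tbl`).  Bricks 2–3:
`…HalfPlanarFrame` (azimuths, the pair lemma), `…BiPlanarRowHalf` (the certificate and the rung).
-/

noncomputable section

namespace Summit.Ventures.Crystal3D.Theorems

open Finset Real
open scoped InnerProductSpace

/-! ## The five species at offset ½ and their certified separations -/

/-- Species heights: `0 ↦ 0`, `1 ↦ a`, `2 ↦ −a`, `3 ↦ 2a`, `4 ↦ −2a`, `a = √(2/3)/2`. -/
def hpH : ℕ → ℝ
  | 0 => 0
  | 1 => Real.sqrt (2 / 3) / 2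
  | 2 => -(Real.sqrt (2 / 3) / 2)
  | 3 => Real.sqrt (2 / 3)
  | 4 => -Real.sqrt (2 / 3)
  | _ => 0

/-- Horizontal radii `r_s = √(1 − h_s²)`. -/
def hpR (s : ℕ) : ℝ := Real.sqrt (1 - hpH s ^ 2)

/-- Certified azimuth separations `δ(s,t)` (radians; `0` = no constraint). -/
def hpDelta (s t : ℕ) : ℝ :=
  if s = 0 ∧ t = 0 then π / 3
  else if (s = 0 ∧ (t = 1 ∨ t = 2)) ∨ (t = 0 ∧ (s = 1 ∨ s = 2)) then 0.98
  else if (s = 0 ∧ (t = 3 ∨ t = 4)) ∨ (t = 0 ∧ (s = 3 ∨ s = 4)) then π / 6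
  else if (s = 1 ∧ t = 1) ∨ (s = 2 ∧ t = 2) then 1.15
  else if (s = 1 ∧ t = 2) ∨ (s = 2 ∧ t = 1) then 0.62
  else if (s = 1 ∧ t = 3) ∨ (s = 3 ∧ t = 1) ∨ (s = 2 ∧ t = 4) ∨ (s = 4 ∧ t = 2) then 1.24
  else if (s = 3 ∧ t = 3) ∨ (s = 4 ∧ t = 4) then 2 * π / 3
  else 0

/-- The integer table (units `10⁻⁴ rad`) fed to the checker. -/
def hpTbl : List (List ℤ) :=
  [[10471, 9800, 9800, 5235, 5235],
   [9800, 11500, 6200, 12400, 0],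
   [9800, 6200, 11500, 0, 12400],
   [5235, 12400, 0, 20943, 0],
   [5235, 0, 12400, 0, 20943]]

/-! ### numerics -/

/-- `√(2/3)² = 2/3`. -/
theorem hp_sqrt23_sq : Real.sqrt (2 / 3) ^ 2 = 2 / 3 := Real.sq_sqrt (by norm_num)

/-- `cos 0.98 ≥ 0.5564`. -/
theorem hp_cos_098 : (0.5564 : ℝ) ≤ Real.cos 0.98 := by
  have hπ1 := Real.pi_gt_d6
  have hπ2 := Real.pi_lt_d6
  rw [← Real.sin_pi_div_two_sub]
  have ht0 : (0 : ℝ) ≤ π / 2 - 0.98 := by linarith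
  have h := Real.sin_ge_sub_cube ht0
  have hlo : (0.590796 : ℝ) ≤ π / 2 - 0.98 := by linarith
  have hhi : π / 2 - 0.98 ≤ (0.5908 : ℝ) := by linarith
  have ht3 : (π / 2 - 0.98) ^ 3 ≤ (0.5908 : ℝ) ^ 3 := pow_le_pow_left₀ ht0 hhi 3
  norm_num at ht3
  linarith [hlo, h, ht3]

/-- `cos 1.15 ≥ 0.4083`. -/
theorem hp_cos_115 : (0.4083 : ℝ) ≤ Real.cos 1.15 := by
  have hπ1 := Real.pi_gt_d6
  have hπ2 := Real.pi_lt_d6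
  rw [← Real.sin_pi_div_two_sub]
  have ht0 : (0 : ℝ) ≤ π / 2 - 1.15 := by linarith
  have h := Real.sin_ge_sub_cube ht0
  have hlo : (0.420796 : ℝ) ≤ π / 2 - 1.15 := by linarith
  have hhi : π / 2 - 1.15 ≤ (0.4208 : ℝ) := by linarith
  have ht3 : (π / 2 - 1.15) ^ 3 ≤ (0.4208 : ℝ) ^ 3 := pow_le_pow_left₀ ht0 hhi 3
  norm_num at ht3
  linarith [hlo, h, ht3]

/-- `cos 1.24 ≥ 0.3247`. -/
theorem hp_cos_124 : (0.3247 : ℝ) ≤ Real.cos 1.24 := by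
  have hπ1 := Real.pi_gt_d6
  have hπ2 := Real.pi_lt_d6
  rw [← Real.sin_pi_div_two_sub]
  have ht0 : (0 : ℝ) ≤ π / 2 - 1.24 := by linarith
  have h := Real.sin_ge_sub_cube ht0
  have hlo : (0.330796 : ℝ) ≤ π / 2 - 1.24 := by linarith
  have hhi : π / 2 - 1.24 ≤ (0.3308 : ℝ) := by linarith
  have ht3 : (π / 2 - 1.24) ^ 3 ≤ (0.3308 : ℝ) ^ 3 := pow_le_pow_left₀ ht0 hhi 3
  norm_num at ht3
  linarith [hlo, h, ht3]

/-- `cos 0.62 ≥ 0.8078`. -/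
theorem hp_cos_062 : (0.8078 : ℝ) ≤ Real.cos 0.62 := by
  have h := Real.one_sub_sq_div_two_le_cos (x := (0.62 : ℝ))
  norm_num at h ⊢
  linarith

/-- `cos (2π/3) = −1/2`. -/
theorem hp_cos_two_pi_div_three : Real.cos (2 * π / 3) = -(1 / 2) := by
  have : 2 * π / 3 = π - π / 3 := by ring
  rw [this, Real.cos_pi_sub, Real.cos_pi_div_three]


/-! ## Species values -/

/-- Species `0` has height `0`. -/
@[simp] theorem hpH_0 : hpH 0 = 0 := rfl
/-- Species `1` has height `a = √(2/3)/2`. -/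
@[simp] theorem hpH_1 : hpH 1 = Real.sqrt (2 / 3) / 2 := rfl
/-- Species `2` has height `−a`. -/
@[simp] theorem hpH_2 : hpH 2 = -(Real.sqrt (2 / 3) / 2) := rfl
/-- Species `3` has height `2a = √(2/3)`. -/
@[simp] theorem hpH_3 : hpH 3 = Real.sqrt (2 / 3) := rfl
/-- Species `4` has height `−2a`. -/
@[simp] theorem hpH_4 : hpH 4 = -Real.sqrt (2 / 3) := rfl

/-- `r₀ = 1`. -/
theorem hpR_zero : hpR 0 = 1 := by simp [hpR]

/-- `r₁ = √(5/6)`. -/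
theorem hpR_one : hpR 1 = Real.sqrt (5 / 6) := by
  rw [hpR, hpH_1]; congr 1; rw [div_pow, hp_sqrt23_sq]; norm_num

/-- `r₂ = √(5/6)`. -/
theorem hpR_two : hpR 2 = Real.sqrt (5 / 6) := by
  rw [hpR, hpH_2]; congr 1; rw [neg_pow, div_pow, hp_sqrt23_sq]; norm_num

/-- `r₃ = √(1/3)`. -/
theorem hpR_three : hpR 3 = Real.sqrt (1 / 3) := by
  rw [hpR, hpH_3]; congr 1; rw [hp_sqrt23_sq]; norm_num

/-- `r₄ = √(1/3)`. -/
theorem hpR_four : hpR 4 = Real.sqrt (1 / 3) := by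
  rw [hpR, hpH_4]; congr 1; rw [neg_pow, hp_sqrt23_sq]; norm_num

/-- `√(5/6) > 0.9128`. -/
theorem hp_sqrt56_gt : (0.9128 : ℝ) < Real.sqrt (5 / 6) := by
  rw [Real.lt_sqrt (by norm_num)]; norm_num

/-- `√(5/6)·√(1/3) = √(5/18)`. -/
theorem hp_sqrt56_mul_sqrt13 : Real.sqrt (5 / 6) * Real.sqrt (1 / 3) = Real.sqrt (5 / 18) := by
  rw [← Real.sqrt_mul (by norm_num)]; norm_num

/-- `√(5/18) > 0.527`. -/
theorem hp_sqrt518_gt : (0.527 : ℝ) < Real.sqrt (5 / 18) := by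
  rw [Real.lt_sqrt (by norm_num)]; norm_num

/-- `a·a = 1/6`. -/
theorem hpA_sq : Real.sqrt (2 / 3) / 2 * (Real.sqrt (2 / 3) / 2) = 1 / 6 := by
  nlinarith [hp_sqrt23_sq]

/-- `a·2a = 1/3`. -/
theorem hpA_B : Real.sqrt (2 / 3) / 2 * Real.sqrt (2 / 3) = 1 / 3 := by
  nlinarith [hp_sqrt23_sq]

/-- `2a·2a = 2/3`. -/
theorem hpB_sq : Real.sqrt (2 / 3) * Real.sqrt (2 / 3) = 2 / 3 := by
  nlinarith [hp_sqrt23_sq]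

/-! ## The KEY inequalities `r_s r_t cos δ(s,t) ≥ ½ − h_s h_t` (seven shapes) -/

/-- KEY for the species pair `(0,0)`. -/
theorem hp_key_00 : (1 : ℝ) / 2 - 0 ≤ 1 * 1 * Real.cos (π / 3) := by
  rw [Real.cos_pi_div_three]; norm_num

/-- KEY for `(0,±a)`. -/
theorem hp_key_0a : (1 : ℝ) / 2 - 0 ≤ 1 * Real.sqrt (5 / 6) * Real.cos 0.98 := by
  have h1 := hp_sqrt56_gt
  have h2 := hp_cos_098
  nlinarith [mul_le_mul h1.le h2 (by norm_num) (Real.sqrt_nonneg _)]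

/-- KEY for `(±a,0)`. -/
theorem hp_key_a0 : (1 : ℝ) / 2 - 0 ≤ Real.sqrt (5 / 6) * 1 * Real.cos 0.98 := by
  have := hp_key_0a; linarith

/-- KEY for `(0,±2a)`. -/
theorem hp_key_0b : (1 : ℝ) / 2 - 0 ≤ 1 * Real.sqrt (1 / 3) * Real.cos (π / 6) := by
  rw [Real.cos_pi_div_six]
  have : Real.sqrt (1 / 3) * Real.sqrt 3 = 1 := by
    rw [← Real.sqrt_mul (by norm_num)]; norm_num
  nlinarith [this]

/-- KEY for `(±2a,0)`. -/
theorem hp_key_b0 : (1 : ℝ) / 2 - 0 ≤ Real.sqrt (1 / 3) * 1 * Real.cos (π / 6) := by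
  have := hp_key_0b; linarith

/-- KEY for `(a,a)` / `(−a,−a)`. -/
theorem hp_key_aa : (1 : ℝ) / 2 - 1 / 6 ≤ Real.sqrt (5 / 6) * Real.sqrt (5 / 6) * Real.cos 1.15 := by
  rw [Real.mul_self_sqrt (by norm_num)]
  have h2 := hp_cos_115
  nlinarith

/-- KEY for `(a,−a)`. -/
theorem hp_key_ab : (1 : ℝ) / 2 - (-(1 / 6)) ≤ Real.sqrt (5 / 6) * Real.sqrt (5 / 6) * Real.cos 0.62 := by
  rw [Real.mul_self_sqrt (by norm_num)]
  have h2 := hp_cos_062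
  nlinarith

/-- KEY for `(a,2a)` / `(−a,−2a)`. -/
theorem hp_key_ac : (1 : ℝ) / 2 - 1 / 3 ≤ Real.sqrt (5 / 6) * Real.sqrt (1 / 3) * Real.cos 1.24 := by
  rw [hp_sqrt56_mul_sqrt13]
  have h1 := hp_sqrt518_gt
  have h2 := hp_cos_124
  nlinarith [mul_le_mul h1.le h2 (by norm_num) (Real.sqrt_nonneg _)]

/-- KEY for `(2a,a)` / `(−2a,−a)`. -/
theorem hp_key_ca : (1 : ℝ) / 2 - 1 / 3 ≤ Real.sqrt (1 / 3) * Real.sqrt (5 / 6) * Real.cos 1.24 := by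
  rw [mul_comm (Real.sqrt (1 / 3))]; exact hp_key_ac

/-- KEY for `(2a,2a)` / `(−2a,−2a)`. -/
theorem hp_key_cc : (1 : ℝ) / 2 - 2 / 3 ≤ Real.sqrt (1 / 3) * Real.sqrt (1 / 3) * Real.cos (2 * π / 3) := by
  rw [Real.mul_self_sqrt (by norm_num), hp_cos_two_pi_div_three]; norm_num

/-- **KEY**: for every species pair, either no separation is claimed (`δ = 0`) or
`r_s · r_t · cos δ(s,t) ≥ ½ − h_s · h_t` with `0 < δ ≤ π`. -/
theorem hp_key (s t : ℕ) (hs : s < 5) (ht : t < 5) :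
    hpDelta s t = 0 ∨
      (1 / 2 - hpH s * hpH t ≤ hpR s * hpR t * Real.cos (hpDelta s t) ∧
        0 < hpDelta s t ∧ hpDelta s t ≤ π) := by
  have hπ1 := Real.pi_gt_d6
  have hπ2 := Real.pi_lt_d6
  have hπ0 : 0 < π := Real.pi_pos
  interval_cases s <;> interval_cases t
  · right; rw [show hpDelta 0 0 = π / 3 by norm_num [hpDelta], hpH_0, hpR_zero, mul_zero]
    exact ⟨hp_key_00, by positivity, by linarith⟩
  · right; rw [show hpDelta 0 1 = 0.98 by norm_num [hpDelta], hpH_0, hpR_zero, hpR_one, zero_mul]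
    exact ⟨hp_key_0a, by norm_num, by linarith⟩
  · right; rw [show hpDelta 0 2 = 0.98 by norm_num [hpDelta], hpH_0, hpR_zero, hpR_two, zero_mul]
    exact ⟨hp_key_0a, by norm_num, by linarith⟩
  · right; rw [show hpDelta 0 3 = π / 6 by norm_num [hpDelta], hpH_0, hpR_zero, hpR_three, zero_mul]
    exact ⟨hp_key_0b, by positivity, by linarith⟩
  · right; rw [show hpDelta 0 4 = π / 6 by norm_num [hpDelta], hpH_0, hpR_zero, hpR_four, zero_mul]
    exact ⟨hp_key_0b, by positivity, by linarith⟩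
  · right; rw [show hpDelta 1 0 = 0.98 by norm_num [hpDelta], hpH_0, hpR_zero, hpR_one, mul_zero]
    exact ⟨hp_key_a0, by norm_num, by linarith⟩
  · right; rw [show hpDelta 1 1 = 1.15 by norm_num [hpDelta], hpH_1, hpR_one, hpA_sq]
    exact ⟨hp_key_aa, by norm_num, by linarith⟩
  · right; rw [show hpDelta 1 2 = 0.62 by norm_num [hpDelta], hpH_1, hpH_2, hpR_one, hpR_two, mul_neg, hpA_sq]
    exact ⟨hp_key_ab, by norm_num, by linarith⟩
  · right; rw [show hpDelta 1 3 = 1.24 by norm_num [hpDelta], hpH_1, hpH_3, hpR_one, hpR_three, hpA_B]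
    exact ⟨hp_key_ac, by norm_num, by linarith⟩
  · left; norm_num [hpDelta]
  · right; rw [show hpDelta 2 0 = 0.98 by norm_num [hpDelta], hpH_0, hpR_zero, hpR_two, mul_zero]
    exact ⟨hp_key_a0, by norm_num, by linarith⟩
  · right; rw [show hpDelta 2 1 = 0.62 by norm_num [hpDelta], hpH_1, hpH_2, hpR_one, hpR_two, neg_mul, hpA_sq]
    exact ⟨hp_key_ab, by norm_num, by linarith⟩
  · right; rw [show hpDelta 2 2 = 1.15 by norm_num [hpDelta], hpH_2, hpR_two, neg_mul_neg, hpA_sq]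
    exact ⟨hp_key_aa, by norm_num, by linarith⟩
  · left; norm_num [hpDelta]
  · right; rw [show hpDelta 2 4 = 1.24 by norm_num [hpDelta], hpH_2, hpH_4, hpR_two, hpR_four, neg_mul_neg, hpA_B]
    exact ⟨hp_key_ac, by norm_num, by linarith⟩
  · right; rw [show hpDelta 3 0 = π / 6 by norm_num [hpDelta], hpH_0, hpR_zero, hpR_three, mul_zero]
    exact ⟨hp_key_b0, by positivity, by linarith⟩
  · right; rw [show hpDelta 3 1 = 1.24 by norm_num [hpDelta], hpH_1, hpH_3, hpR_one, hpR_three,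
      mul_comm (Real.sqrt (2 / 3)), hpA_B]
    exact ⟨hp_key_ca, by norm_num, by linarith⟩
  · left; norm_num [hpDelta]
  · right; rw [show hpDelta 3 3 = 2 * π / 3 by norm_num [hpDelta], hpH_3, hpR_three, hpB_sq]
    exact ⟨hp_key_cc, by positivity, by linarith⟩
  · left; norm_num [hpDelta]
  · right; rw [show hpDelta 4 0 = π / 6 by norm_num [hpDelta], hpH_0, hpR_zero, hpR_four, mul_zero]
    exact ⟨hp_key_b0, by positivity, by linarith⟩
  · left; norm_num [hpDelta]
  · right; rw [show hpDelta 4 2 = 1.24 by norm_num [hpDelta], hpH_2, hpH_4, hpR_two, hpR_four, neg_mul_neg,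
      mul_comm (Real.sqrt (2 / 3)), hpA_B]
    exact ⟨hp_key_ca, by norm_num, by linarith⟩
  · left; norm_num [hpDelta]
  · right; rw [show hpDelta 4 4 = 2 * π / 3 by norm_num [hpDelta], hpH_4, hpR_four, neg_mul_neg, hpB_sq]
    exact ⟨hp_key_cc, by positivity, by linarith⟩

/-- The integer table under-estimates `10⁴ · δ`. -/
theorem hp_tbl (s t : ℕ) (hs : s < 5) (ht : t < 5) :
    ((azGet hpTbl s t : ℤ) : ℝ) ≤ 10000 * hpDelta s t := by
  have hπ1 := Real.pi_gt_d6
  interval_cases s <;> interval_cases t <;> norm_num [hpDelta, hpTbl, azGet] <;> nlinarith [hπ1]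

end Summit.Ventures.Crystal3D.Theorems

end
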